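import Summits.Ventures.PercRepro.C041ZonePortCSDefs

/-!
# THEOREM R-CS on the zone port problem — the gates made ordinary, and the all-pure-`{1}` case (p6, gen 28)

Setting of `C041ZonePortCSDefs` (mine-3, C-041.md §17 (a) (iv), second half, and (v)).  When EVERY gate is switchable
and of pure type `{1}`, the paper passes to the port problem `P^F` in which the gates are made ORDINARY vertices:
here `P.unport S` — the SAME graph, root set and terminal edges, with the zones of `S` removed from the ports
(their terminal edges disappear from the pattern).  The dictionary, for `S` a set of switchable pure-`{1}` gates:

* a pattern of `P` is a colouring of the terminal edges at `S` together with a pattern of `P.unport S`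
  (`restrictU`, `extendU b` — all edges at `S` coloured `b`); admissibility is the same on both sides
  (`adm_extendU_iff`), the deleted sets agree (`A₂_extendU`, `A₁_extendU_true`), reachability is literally the same;
* a valid pattern of `P` that is NOT `Good₂` has every edge at the gates blue (a red 1-edge at a pure-`{1}` gate is
  `Good₂` by THE KEY FACT), so it is the CLOSED extension of its restriction, which is valid and not `Good₂` in
  `P.unport S`, and conversely: `#valid − #Good₂` is the same in both problems (`card_notGood₂_eq`);
* the ALL-RED extension of a valid `Good₁` pattern of `P.unport S` is a valid `Good₁` pattern of `P`
  (`card_good₁_unport_le`): `#Good₁ ≥ #Good₁′`.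

Hence `#valid − #Good₁ − #Good₂ ≤ #valid′ − #Good₁′ − #Good₂′` and (CS) for `P` follows from (CS) for `P.unport S`
by monotonicity (**`csOr_of_pure₁_gates`**) — the paper's `v − x − y ≤ V′ − X₁^F − G₂^F ≤ √(X₁^F·G₂^F) ≤ √(xy)`,
which also covers the paper's case (v) (a unique gate with a single edge).  `P.unport S` has fewer zones
(`card_unport_Z_lt`) and its zones stay reached (`zonesReached_unport`): the induction hypothesis applies.
-/

namespace PercRepro

namespace ZonePort

namespace Problem

open Finset CSCount

variable {V E : Type*}

section PureOne

variable {P : Problem V E} {S : Finset (Finset V)}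

/-- A 2-edge of `P` is not at a set `S` of pure-`{1}` zones. -/
theorem tz_not_mem_of_two (hS₁ : ∀ C ∈ S, P.Pure₁ C) {e : P.Term} (he : P.ts e.1 = true) : P.tz e.1 ∉ S :=
  fun h => by
  have := hS₁ _ h e rfl
  rw [he] at this
  exact Bool.noConfusion this

/-- A valid pattern of `P` that is not `Good₂` has every edge at a set of pure-`{1}` gates blue. -/
theorem blue_at_gates_of_not_good₂ (hSg : ∀ C ∈ S, P.IsGate C) (hS₁ : ∀ C ∈ S, P.Pure₁ C) {x : P.Term → Bool}
    (h2 : ¬ P.Good₂ x) : ∀ e : P.Term, P.tz e.1 ∈ S → x e = false := by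
  intro e he
  by_contra hne
  exact h2 (good₂_of_red_pure_gate (hSg _ he) (hS₁ _ he e rfl) (hS₁ _ he) (Bool.eq_true_of_not_eq_false hne))

end PureOne

section Unport

variable [DecidableEq V]

/-- The problem with the zones of `S` made ordinary vertices: the same graph, root set and terminal edges, the
zones `Z \ S`. -/
def unport (P : Problem V E) (S : Finset (Finset V)) : Problem V E where
  adj := P.adj
  symm := P.symm
  root := P.root
  Z := P.Z \ S
  hdisj C hC D hD := P.hdisj C (Finset.mem_sdiff.1 hC).1 D (Finset.mem_sdiff.1 hD).1
  hroot C hC := P.hroot C (Finset.mem_sdiff.1 hC).1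
  hzconn C hC := P.hzconn C (Finset.mem_sdiff.1 hC).1
  tv := P.tv
  ts := P.ts
  tz := P.tz
  htv := P.htv
  sw := P.sw
  hk C hC := P.hk C (Finset.mem_sdiff.1 hC).1

variable {P : Problem V E} {S : Finset (Finset V)}

/-- A term of `P.unport S` is a term of `P`. -/
def liftU (P : Problem V E) (S : Finset (Finset V)) (e : (P.unport S).Term) : P.Term :=
  ⟨e.1, (Finset.mem_sdiff.1 e.2).1⟩

/-- The zone of a term of `P.unport S` is not in `S`. -/
theorem tz_liftU_not_mem (e : (P.unport S).Term) : P.tz (P.liftU S e).1 ∉ S := (Finset.mem_sdiff.1 e.2).2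

/-- The restriction of a pattern of `P` to the terms of `P.unport S`. -/
def restrictU (P : Problem V E) (S : Finset (Finset V)) (x : P.Term → Bool) : (P.unport S).Term → Bool :=
  fun e => x (P.liftU S e)

/-- The extension of a pattern of `P.unport S` by the colour `b` on every edge at `S`. -/
def extendU (P : Problem V E) (S : Finset (Finset V)) (b : Bool) (x' : (P.unport S).Term → Bool) :
    P.Term → Bool :=
  fun e => if h : P.tz e.1 ∈ S then b else x' ⟨e.1, Finset.mem_sdiff.2 ⟨e.2, h⟩⟩

/-- The extension at an edge of `S`. -/
theorem extendU_of_mem (b : Bool) (x' : (P.unport S).Term → Bool) {e : P.Term} (h : P.tz e.1 ∈ S) :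
    P.extendU S b x' e = b := by
  unfold extendU
  rw [dif_pos h]

/-- The extension at an edge outside `S`. -/
theorem extendU_of_not_mem (b : Bool) (x' : (P.unport S).Term → Bool) {e : P.Term} (h : P.tz e.1 ∉ S) :
    P.extendU S b x' e = x' ⟨e.1, Finset.mem_sdiff.2 ⟨e.2, h⟩⟩ := by
  unfold extendU
  rw [dif_neg h]

/-- The extension restricted is the pattern. -/
theorem restrictU_extendU (b : Bool) (x' : (P.unport S).Term → Bool) : P.restrictU S (P.extendU S b x') = x' := by
  funext e
  unfold restrictU
  rw [extendU_of_not_mem b x' (tz_liftU_not_mem e)]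
  rfl

/-- A pattern whose edges at `S` are all `b` is the `b`-extension of its restriction. -/
theorem extendU_restrictU (b : Bool) {x : P.Term → Bool} (hx : ∀ e : P.Term, P.tz e.1 ∈ S → x e = b) :
    P.extendU S b (P.restrictU S x) = x := by
  funext e
  by_cases h : P.tz e.1 ∈ S
  · rw [extendU_of_mem b _ h, hx e h]
  · rw [extendU_of_not_mem b _ h]
    rfl

/-- The zones of `P.unport S` are zones of `P`. -/
theorem unport_Z_subset : (P.unport S).Z ⊆ P.Z := Finset.sdiff_subset

/-- Reachability in `P.unport S` is reachability in `P`. -/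
theorem rreach_unport (A : Set V) (v : V) : (P.unport S).RReach A v ↔ P.RReach A v := Iff.rfl

/-- The zones of `P.unport S` are reached when those of `P` are. -/
theorem zonesReached_unport (h : P.ZonesReached) : (P.unport S).ZonesReached :=
  fun C hC => h C (unport_Z_subset hC)

/-- Removing a zone of `P` from the ports lowers the number of zones. -/
theorem card_unport_Z_lt {C : Finset V} (hC : C ∈ P.Z) (hCS : C ∈ S) : (P.unport S).Z.card < P.Z.card :=
  Finset.card_lt_card ((Finset.ssubset_iff_of_subset Finset.sdiff_subset).2
    ⟨C, hC, fun h => (Finset.mem_sdiff.1 h).2 hCS⟩)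

/-! ## The dictionary for a set `S` of switchable pure-`{1}` zones -/

variable (hS₁ : ∀ C ∈ S, P.Pure₁ C) (hSsw : ∀ C ∈ S, P.sw C = true)

include hS₁ hSsw in
/-- Admissibility is the same on both sides of the extension. -/
theorem adm_extendU_iff (b : Bool) (x' : (P.unport S).Term → Bool) :
    P.Adm (P.extendU S b x') ↔ (P.unport S).Adm x' := by
  constructor
  · rintro ⟨h1, h2⟩
    refine ⟨fun e he => ?_, fun e f hef he hf => ?_⟩
    · have := h1 (P.liftU S e) he
      rwa [extendU_of_not_mem b x' (tz_liftU_not_mem e)] at this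
    · have := h2 (P.liftU S e) (P.liftU S f) hef he hf
      rwa [extendU_of_not_mem b x' (tz_liftU_not_mem e), extendU_of_not_mem b x' (tz_liftU_not_mem f)] at this
  · rintro ⟨h1, h2⟩
    refine ⟨fun e he => ?_, fun e f hef he hf => ?_⟩
    · by_cases h : P.tz e.1 ∈ S
      · rw [hSsw _ h] at he
        exact Bool.noConfusion he
      · rw [extendU_of_not_mem b x' h]
        exact h1 ⟨e.1, Finset.mem_sdiff.2 ⟨e.2, h⟩⟩ he
    · have hf' : P.tz f.1 ∉ S := tz_not_mem_of_two hS₁ hf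
      have he' : P.tz e.1 ∉ S := fun h => hf' (hef ▸ h)
      rw [extendU_of_not_mem b x' he', extendU_of_not_mem b x' hf']
      exact h2 ⟨e.1, Finset.mem_sdiff.2 ⟨e.2, he'⟩⟩ ⟨f.1, Finset.mem_sdiff.2 ⟨f.2, hf'⟩⟩ hef he hf

include hS₁ in
/-- The side-`2` deleted set is the same on both sides of the extension. -/
theorem A₂_extendU (b : Bool) (x' : (P.unport S).Term → Bool) :
    P.A₂ (P.extendU S b x') = (P.unport S).A₂ x' := by
  ext v
  constructor
  · rintro ⟨e, he, hxe, hv⟩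
    have h : P.tz e.1 ∉ S := tz_not_mem_of_two hS₁ he
    rw [extendU_of_not_mem b x' h] at hxe
    exact ⟨⟨e.1, Finset.mem_sdiff.2 ⟨e.2, h⟩⟩, he, hxe, hv⟩
  · rintro ⟨e, he, hxe, hv⟩
    refine ⟨P.liftU S e, he, ?_, hv⟩
    rw [extendU_of_not_mem b x' (tz_liftU_not_mem e)]
    exact hxe

/-- With every edge at `S` red, the side-`1` deleted set is the same on both sides of the extension. -/
theorem A₁_extendU_true (x' : (P.unport S).Term → Bool) :
    P.A₁ (P.extendU S true x') = (P.unport S).A₁ x' := by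
  ext v
  constructor
  · rintro ⟨e, he, hxe, hv⟩
    have h : P.tz e.1 ∉ S := fun h => by
      rw [extendU_of_mem true x' h] at hxe
      exact Bool.noConfusion hxe
    rw [extendU_of_not_mem true x' h] at hxe
    exact ⟨⟨e.1, Finset.mem_sdiff.2 ⟨e.2, h⟩⟩, he, hxe, hv⟩
  · rintro ⟨e, he, hxe, hv⟩
    refine ⟨P.liftU S e, he, ?_, hv⟩
    rw [extendU_of_not_mem true x' (tz_liftU_not_mem e)]
    exact hxe

include hS₁ in
/-- `X₂` is the same on both sides of the extension. -/
theorem X₂_extendU_iff (b : Bool) (x' : (P.unport S).Term → Bool) :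
    P.X₂ (P.extendU S b x') ↔ (P.unport S).X₂ x' := by
  constructor
  · rintro ⟨e, he, hxe⟩
    have h : P.tz e.1 ∉ S := tz_not_mem_of_two hS₁ he
    rw [extendU_of_not_mem b x' h] at hxe
    exact ⟨⟨e.1, Finset.mem_sdiff.2 ⟨e.2, h⟩⟩, he, hxe⟩
  · rintro ⟨e, he, hxe⟩
    refine ⟨P.liftU S e, he, ?_⟩
    rw [extendU_of_not_mem b x' (tz_liftU_not_mem e)]
    exact hxe

/-- With every edge at `S` blue, `X₁` is the same on both sides of the extension. -/
theorem X₁_extendU_false_iff (x' : (P.unport S).Term → Bool) :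
    P.X₁ (P.extendU S false x') ↔ (P.unport S).X₁ x' := by
  constructor
  · rintro ⟨e, he, hxe⟩
    have h : P.tz e.1 ∉ S := fun h => by
      rw [extendU_of_mem false x' h] at hxe
      exact Bool.noConfusion hxe
    rw [extendU_of_not_mem false x' h] at hxe
    exact ⟨⟨e.1, Finset.mem_sdiff.2 ⟨e.2, h⟩⟩, he, hxe⟩
  · rintro ⟨e, he, hxe⟩
    refine ⟨P.liftU S e, he, ?_⟩
    rw [extendU_of_not_mem false x' (tz_liftU_not_mem e)]
    exact hxe

include hS₁ in
/-- With an edge at `S` and every edge at `S` red, `X₁` holds. -/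
theorem X₁_extendU_true {e : P.Term} (he : P.tz e.1 ∈ S) (x' : (P.unport S).Term → Bool) :
    P.X₁ (P.extendU S true x') :=
  ⟨e, hS₁ _ he e rfl, extendU_of_mem true x' he⟩

include hS₁ in
/-- With every edge at `S` red, `Good₁` is the same on both sides of the extension. -/
theorem good₁_extendU_true_iff (x' : (P.unport S).Term → Bool) :
    P.Good₁ (P.extendU S true x') ↔ (P.unport S).Good₁ x' := by
  unfold Good₁
  rw [A₁_extendU_true]
  constructor
  · rintro ⟨e, he, hxe, hr⟩
    have h : P.tz e.1 ∉ S := tz_not_mem_of_two hS₁ he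
    rw [extendU_of_not_mem true x' h] at hxe
    exact ⟨⟨e.1, Finset.mem_sdiff.2 ⟨e.2, h⟩⟩, he, hxe, hr⟩
  · rintro ⟨e, he, hxe, hr⟩
    refine ⟨P.liftU S e, he, ?_, hr⟩
    rw [extendU_of_not_mem true x' (tz_liftU_not_mem e)]
    exact hxe

include hS₁ in
/-- With every edge at `S` blue, `Good₂` is the same on both sides of the extension. -/
theorem good₂_extendU_false_iff (x' : (P.unport S).Term → Bool) :
    P.Good₂ (P.extendU S false x') ↔ (P.unport S).Good₂ x' := by
  unfold Good₂
  rw [A₂_extendU hS₁]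
  constructor
  · rintro ⟨e, he, hxe, hr⟩
    have h : P.tz e.1 ∉ S := fun h => by
      rw [extendU_of_mem false x' h] at hxe
      exact Bool.noConfusion hxe
    rw [extendU_of_not_mem false x' h] at hxe
    exact ⟨⟨e.1, Finset.mem_sdiff.2 ⟨e.2, h⟩⟩, he, hxe, hr⟩
  · rintro ⟨e, he, hxe, hr⟩
    refine ⟨P.liftU S e, he, ?_, hr⟩
    rw [extendU_of_not_mem false x' (tz_liftU_not_mem e)]
    exact hxe

include hS₁ hSsw in
/-- With every edge at `S` blue, validity is the same on both sides of the extension. -/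
theorem validOr_extendU_false_iff (x' : (P.unport S).Term → Bool) :
    P.ValidOr (P.extendU S false x') ↔ (P.unport S).ValidOr x' :=
  and_congr (adm_extendU_iff hS₁ hSsw false x') (or_congr (X₁_extendU_false_iff x') (X₂_extendU_iff hS₁ false x'))

end Unport

section Counts

variable [Fintype E] [DecidableEq E] [DecidableEq V] {P : Problem V E} {S : Finset (Finset V)}

open Classical in
/-- The valid patterns that are not `Good₂`. -/
noncomputable def notGood₂Set (P : Problem V E) : Finset (P.Term → Bool) :=
  P.validSet.filter fun x => ¬ P.Good₂ x

/-- `#valid = #Good₂ + #(valid ∖ Good₂)`. -/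
theorem card_validSet_eq_good₂_add : #(P.validSet) = #(P.good₂Set) + #(P.notGood₂Set) := by
  classical
  unfold notGood₂Set
  rw [good₂Set_eq_filter]
  exact (Finset.card_filter_add_card_filter_not _).symm

/-- Membership in the valid patterns that are not `Good₂`. -/
theorem mem_notGood₂Set {x : P.Term → Bool} : x ∈ P.notGood₂Set ↔ P.ValidOr x ∧ ¬ P.Good₂ x := by
  classical
  unfold notGood₂Set
  rw [Finset.mem_filter, mem_validSet]

/-- **The valid patterns that are not `Good₂` correspond** across the extension, for a set `S` of switchable
pure-`{1}` gates: `#(valid ∖ Good₂) = #(valid′ ∖ Good₂′)`. -/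
theorem card_notGood₂_eq (hSg : ∀ C ∈ S, P.IsGate C) (hS₁ : ∀ C ∈ S, P.Pure₁ C) (hSsw : ∀ C ∈ S, P.sw C = true) :
    #(P.notGood₂Set) = #((P.unport S).notGood₂Set) := by
  refine Finset.card_nbij' (P.restrictU S) (P.extendU S false) ?_ ?_ ?_ ?_
  · intro x hx
    rw [Finset.mem_coe, mem_notGood₂Set] at hx
    rw [Finset.mem_coe, mem_notGood₂Set]
    have hx' : P.extendU S false (P.restrictU S x) = x :=
      extendU_restrictU false (blue_at_gates_of_not_good₂ hSg hS₁ hx.2)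
    rw [← validOr_extendU_false_iff hS₁ hSsw, ← good₂_extendU_false_iff hS₁, hx']
    exact hx
  · intro x' hx'
    rw [Finset.mem_coe, mem_notGood₂Set] at hx'
    rw [Finset.mem_coe, mem_notGood₂Set, validOr_extendU_false_iff hS₁ hSsw, good₂_extendU_false_iff hS₁]
    exact hx'
  · intro x hx
    rw [Finset.mem_coe, mem_notGood₂Set] at hx
    exact extendU_restrictU false (blue_at_gates_of_not_good₂ hSg hS₁ hx.2)
  · intro x' _
    exact restrictU_extendU false x'

/-- **The valid `Good₁` patterns of `P.unport S` inject into those of `P`** (the all-red extension), for a set `S`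
of switchable pure-`{1}` zones carrying an edge. -/
theorem card_good₁_unport_le (hS₁ : ∀ C ∈ S, P.Pure₁ C) (hSsw : ∀ C ∈ S, P.sw C = true) {e : P.Term}
    (he : P.tz e.1 ∈ S) : #((P.unport S).good₁Set) ≤ #(P.good₁Set) := by
  refine Finset.card_le_card_of_injOn (P.extendU S true) ?_ ?_
  · intro x' hx'
    rw [Finset.mem_coe, mem_good₁Set] at hx'
    rw [Finset.mem_coe, mem_good₁Set]
    refine ⟨⟨(adm_extendU_iff hS₁ hSsw true x').2 hx'.1.1, Or.inl (X₁_extendU_true hS₁ he x')⟩, ?_⟩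
    exact (good₁_extendU_true_iff hS₁ x').2 hx'.2
  · intro x' _ y' _ hxy
    have := congrArg (P.restrictU S) hxy
    rwa [restrictU_extendU, restrictU_extendU] at this

/-- **The valid `Good₂` patterns of `P.unport S` inject into those of `P`** (the closed extension), for a set `S`
of switchable pure-`{1}` zones. -/
theorem card_good₂_unport_le (hS₁ : ∀ C ∈ S, P.Pure₁ C) (hSsw : ∀ C ∈ S, P.sw C = true) :
    #((P.unport S).good₂Set) ≤ #(P.good₂Set) := by
  refine Finset.card_le_card_of_injOn (P.extendU S false) ?_ ?_
  · intro x' hx'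
    rw [Finset.mem_coe, mem_good₂Set] at hx'
    rw [Finset.mem_coe, mem_good₂Set, validOr_extendU_false_iff hS₁ hSsw, good₂_extendU_false_iff hS₁]
    exact hx'
  · intro x' _ y' _ hxy
    have := congrArg (P.restrictU S) hxy
    rwa [restrictU_extendU, restrictU_extendU] at this

/-- **(CS) for `P` from (CS) for `P.unport S`**, `S` a nonempty set of switchable pure-`{1}` gates: the excess
`#valid − #Good₁ − #Good₂` does not increase and the Good counts do not decrease. -/
theorem csOr_of_pure₁_gates (hSg : ∀ C ∈ S, P.IsGate C) (hS₁ : ∀ C ∈ S, P.Pure₁ C) (hSsw : ∀ C ∈ S, P.sw C = true)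
    {e : P.Term} (he : P.tz e.1 ∈ S) (h : (P.unport S).CSOr) : P.CSOr := by
  have h1 := card_validSet_eq_good₂_add (P := P)
  have h2 := card_validSet_eq_good₂_add (P := P.unport S)
  have h3 := card_notGood₂_eq hSg hS₁ hSsw
  have h4 := card_good₁_unport_le hS₁ hSsw he
  have h5 := card_good₂_unport_le hS₁ hSsw
  unfold CSOr at h ⊢
  exact cs_mono h h4 h5 (by omega)

end Counts

end Problem

end ZonePort

end PercRepro
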